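import Summits.SmoothPoincare4.SmoothPoincare4.Theorems.DottedCircleRasmussenDcrGapHelperFriendsCarrierVkPartCSize

/-!
# Helper `helper_friendsCarrier_Vk_partC` (V_k part C: the collar of the uninverted model disc exterior) —
# final piece: the end clauses and the registered statement
(item stmt-SmoothPoincare4-16128, route route-SmoothPoincare4-DottedCircleRasmussen)

Last piece of the port of the tree's `SliceDiscEndCollar.lean` (`ConicalDiscTube.collarPH`,
`exists_endCollar`) to the model `M_k = ∂D_k ⊂ ℝ⁴` (pieces `…VkPartCDatum`, `…Chart`, `…Formulas`,
`…Region`, `…Smooth`, `…SmoothInv`, `…Size`).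

* the far part `{z ∈ O | M z ≤ e^{-a}}` of the exterior `O = ℝ⁴ ∖ (D_k ∪ Δ)` is CLOSED IN `ℝ⁴`: it is
  relatively closed in `O` (continuity of the size `M`), and its closure misses `D_k ∪ Δ` — it misses the
  open neighbourhood `{off the poles, G_k < 1 + ℓ_a}` of `D_k` (`ℓ_a = Einv s₀ e^{-a}`: there the depth size
  exceeds `e^{-a}`) and the open neighbourhood `G(D̊² × B(0, r_a))` of the open disc (`r_a = Einv 1 e^{-a}`:
  there the normal-radius size exceeds `e^{-a}`), which together cover `D_k ∪ Δ` (the boundary circle of the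
  disc is `K₁ ⊂ D_k`) — the replacement of the template's compactness of `core ∪ c(Y × [a, ∞))` in the
  unbounded exterior;
* the collar region is bounded (inside the compact `Φ([0, s₀] × M_k) ∪ G(B̄ × B̄) ∪ Φ([0, s₁/2] × unit tube)`);
* `helper_friendsCarrier_Vk_partC` — THE REGISTERED STUB (V_k part C): the collar packaged as an
  `OpenPartialHomeomorph (Y × ℝ) E` with source `Y × ℝ`, `C^∞` both ways, closed sublevel images, closed
  `c.targetᶜ ∪ c(Y × [a, ∞))` in `ℝ⁴`, bounded image, and core loop `c(jB(0, v), 0) = G(0, v/2)`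
  (`Einv 1 1 = 1/2`).

Everything is proved; no definitions, no named facts, no `sorry`.
References: Manolescu–Piccirillo (2023), §3.2, proof of Lemma 3.3 [ManolescuPiccirillo2023]; Kosinski (1993),
Ch. VI §5 [Kosinski1993]; Kirby (1989), Ch. I §5 [Kirby1989].
-/

-- the prescribed namespace `Summit.<P>.<Sub>.…` duplicates `SmoothPoincare4` (P = Sub)
set_option linter.dupNamespace false
set_option linter.style.longLine false

noncomputable section

open scoped Manifold ContDiff Topology
open Function Set Metric TopologicalSpace
open Literature.Topology.FourManifolds Literature.Topology.FourManifolds.MMSW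
open Literature.AlgebraicTopology.Homotopy.HopfFibration

namespace Summit.SmoothPoincare4.SmoothPoincare4.Theorems.DcrGap.MkFriends

namespace FriendsVk

namespace CollarDatum

variable {k : ℕ} (V : CollarDatum k)

/-! ### The far part of the exterior is closed in `ℝ⁴` -/

/-- The exterior is open. [folklore] -/
theorem isOpen_O : IsOpen V.O := by
  have : V.O = (modelHandlebody k ∪ V.disc)ᶜ := by ext x; simp [CollarDatum.O, CollarDatum.disc]
  rw [this]; exact ((isClosed_modelHandlebody k).union V.isClosed_disc).isOpen_compl

/-- **The closure of a far part of the exterior stays in the exterior**: points of the exterior near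
`D_k ∪ Δ` have large size. [folklore] -/
theorem closure_sublevel_subset_O (a : ℝ) : closure {z | z ∈ V.O ∧ V.M z ≤ Real.exp (-a)} ⊆ V.O := by
  have hℓm := SliceCollar.Einv_mem V.s₀_pos (Real.exp (-a))
  have hrm := SliceCollar.Einv_mem one_pos (Real.exp (-a))
  set ℓ := SliceCollar.Einv V.s₀ (Real.exp (-a)) with hℓ
  set r := SliceCollar.Einv 1 (Real.exp (-a)) with hr
  set U : Set (EuclideanSpace ℝ (Fin 4)) := {y | y ∈ {y : EuclideanSpace ℝ (Fin 4) | ∀ j : Fin k, 0 < holeTerm k j y} ∧ levelFun k y < 1 + ℓ} with hU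
  set T : Set (EuclideanSpace ℝ (Fin 4)) := V.G '' (ball (0 : EuclideanSpace ℝ (Fin 2)) 1 ×ˢ ball (0 : EuclideanSpace ℝ (Fin 2)) r) with hT
  have hUo : IsOpen U := by
    have hc : ContinuousOn (levelFun k) {y : EuclideanSpace ℝ (Fin 4) | ∀ j : Fin k, 0 < holeTerm k j y} :=
      fun y hy => (contDiffAt_levelFun fun j => (hy j).ne').continuousAt.continuousWithinAt
    exact hc.isOpen_inter_preimage (FriendsCarrierVk.isOpen_offPoles k) isOpen_Iio
  have hTo : IsOpen T := V.isOpen_image (isOpen_ball.prod isOpen_ball) fun q hq =>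
    ConicalDiscTube.mem_dom_iff.2 ⟨by simpa using hq.1, by have := hq.2; rw [mem_ball, dist_zero_right] at this; linarith [hrm.2]⟩
  -- the sublevel set misses `U` and `T`
  have hsub : {z | z ∈ V.O ∧ V.M z ≤ Real.exp (-a)} ⊆ Uᶜ ∩ Tᶜ := by
    rintro z ⟨hzO, hM⟩
    have hρ0 := V.ρ_nonneg z
    have hχ0 := V.χ_nonneg z
    constructor
    · rintro ⟨hhole, hlev⟩
      have hhole' : ∀ j : Fin k, 0 < holeTerm k j z := hhole
      rcases le_or_gt (levelFun k z) 1 with hle | hgt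
      · exact hzO.1 ⟨fun j => by
          have h := ((FriendsH2.levelFun_bounds hhole').2.2 j).trans hle
          rwa [div_le_one (hhole' j)] at h, hle⟩
      · have hband : z ∈ V.band := ⟨hhole', by rw [abs_lt]; constructor <;> linarith [hℓm.2, V.s₀_lt_two]⟩
        have hd0 : 0 < depth k z := by change 0 < levelFun k z - 1; linarith
        have hdℓ : depth k z < ℓ := by change levelFun k z - 1 < ℓ; linarith
        have hshell : z ∈ V.shell V.s₀ := ⟨hband, hd0, by linarith [hℓm.2]⟩
        have hlt : Real.exp (-a) < V.ρ z := by
          rw [V.ρ_of_mem_shell hshell, ← SliceCollar.E_Einv V.s₀ (Real.exp_pos (-a))]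
          exact SliceCollar.E_lt_E hd0 hdℓ hℓm.2.le
        have : V.M z = V.ρ z + V.χ z := rfl
        linarith
    · rintro ⟨⟨x, w⟩, ⟨hx, hw⟩, hz⟩
      rw [mem_ball, dist_zero_right] at hx hw
      have hdom : ((x, w) : (EuclideanSpace ℝ (Fin 2)) × (EuclideanSpace ℝ (Fin 2))) ∈ (ConicalDiscTube.dom : Set ((EuclideanSpace ℝ (Fin 2)) × (EuclideanSpace ℝ (Fin 2)))) :=
        ConicalDiscTube.mem_dom_iff.2 ⟨hx, by linarith [hrm.2]⟩
      have hw0 : w ≠ 0 := V.snd_ne_zero_of_not_mem_disc hdom (by rw [hz]; exact hzO.2)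
      have hlt : Real.exp (-a) < V.χ z := by
        rw [← hz, V.χ_of_mem ⟨_, hdom, rfl⟩, V.Ginv_apply hdom, ← SliceCollar.E_Einv 1 (Real.exp_pos (-a))]
        exact SliceCollar.E_lt_E (norm_pos_iff.2 hw0) hw hrm.2.le
      have : V.M z = V.ρ z + V.χ z := rfl
      linarith
  -- `D_k ∪ Δ ⊆ U ∪ T`
  have hcov : ∀ z, z ∉ V.O → z ∈ U ∪ T := by
    intro z hz
    by_cases hD : z ∈ modelHandlebody k
    · exact Or.inl ⟨fun j => lt_of_lt_of_le one_pos (hD.1 j), by linarith [hD.2, hℓm.1]⟩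
    · have hdisc : z ∈ V.disc := by
        by_contra h; exact hz ⟨hD, h⟩
      obtain ⟨x, hx, rfl⟩ := hdisc
      rw [mem_closedBall, dist_zero_right] at hx
      rcases hx.lt_or_eq with hlt | heq
      · refine Or.inr ⟨(x, 0), ⟨by rwa [mem_ball, dist_zero_right], by rw [mem_ball, dist_zero_right, norm_zero]; exact hrm.1⟩, ?_⟩
        exact V.apply_zero x (by rwa [mem_ball, dist_zero_right])
      · exact absurd (V.g_mem_modelHandlebody_of_norm_eq_one heq) hD
  intro z hz
  by_contra hzO
  have hmem : z ∈ Uᶜ ∩ Tᶜ := ((hUo.isClosed_compl.inter hTo.isClosed_compl).closure_subset_iff.2 hsub) hz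
  rcases hcov z hzO with h | h
  · exact hmem.1 h
  · exact hmem.2 h

/-- **The far part of the exterior is closed in `ℝ⁴`.** [folklore] -/
theorem isClosed_sublevel (a : ℝ) : IsClosed {z | z ∈ V.O ∧ V.M z ≤ Real.exp (-a)} :=
  isClosed_of_closure_subset fun _ hz => V.closure_setOf_M_le_inter ⟨hz, V.closure_sublevel_subset_O a hz⟩

/-- **The collar region is bounded.** [folklore] -/
theorem exists_norm_le_of_mem_region : ∃ R : ℝ, ∀ z ∈ V.region, ‖z‖ ≤ R := by
  have hK : IsCompact (V.Φ '' (Icc 0 V.s₀ ×ˢ modelBoundary k) ∪ (V.G '' (closedBall (0 : EuclideanSpace ℝ (Fin 2)) (1 - V.s₁ / 2) ×ˢ closedBall (0 : EuclideanSpace ℝ (Fin 2)) 1) ∪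
      V.Φ '' (Icc 0 (V.s₁ / 2) ×ˢ V.unitTube))) := (V.isCompact_image_Icc V.s₀).union V.isCompact_tubeHull
  have hsub : V.region ⊆ V.Φ '' (Icc 0 V.s₀ ×ˢ modelBoundary k) ∪ (V.G '' (closedBall (0 : EuclideanSpace ℝ (Fin 2)) (1 - V.s₁ / 2) ×ˢ closedBall (0 : EuclideanSpace ℝ (Fin 2)) 1) ∪
      V.Φ '' (Icc 0 (V.s₁ / 2) ×ˢ V.unitTube)) := by
    rintro z (⟨hz, -⟩ | ⟨q, hq, rfl⟩)
    · exact Or.inl (V.shell_subset_image V.s₀ hz)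
    · exact Or.inr (V.image_unitBall_subset_tubeHull ⟨q, ⟨hq.1, hq.2.1⟩, rfl⟩)
  obtain ⟨R, hR⟩ := (hK.isBounded.subset hsub).exists_norm_le
  exact ⟨R, hR⟩

end CollarDatum

end FriendsVk

/-- **V_k part C: the collar of the uninverted model disc exterior** (registered stub
`helper_friendsCarrier_Vk_partC` of line `mk_friends`, crux `DcrGap`).  For a clocked complete flow `Φ` of
`ℝ⁴` along `M_k`, a model slice disc `g` of `K₁` which is the flow line near the circle, a tube `ν` of
`K₁` in `M_k`, a trivialised tube `G` of the open disc (the flow-out of `ν` over the band, deep part off the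
thin shell), and the `3`-manifold `Y` presented as `M_k` surgered along `K₁` through `ν`, the exterior
`E = ℝ⁴ ∖ (D_k ∪ g(𝔻²))` has a collar `c : Y × ℝ ⇀ E` — shell formula `Φ(ℓ, a)`, tube formula
`G((1 - ℓ)u, r ŵ)` with `(ℓ, r) = Ψ⁻¹(‖w‖, σ)`, flat formula `G(4p, Einv 1 e^{-σ} v)` — with source
`Y × ℝ`, `C^∞` with `C^∞` inverse, closed sublevel images in `E`, closed `(c.target)ᶜ ∪ c(Y × [a, ∞))` in
`ℝ⁴`, bounded image, and core loop `c(jB(0, v), 0) = G(0, v/2)`: the port of the tree's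
`SliceDiscEndCollar.lean` (`k = 0`) over the flow chart of `M_k` (Manolescu–Piccirillo 2023, §3.2, proof of
Lemma 3.3; Kosinski 1993, Ch. VI §5). [cite: ManolescuPiccirillo2023, §3.2 proof of Lemma 3.3] -/
theorem helper_friendsCarrier_Vk_partC : ∀ (k : ℕ) (K₁ : (sphere (0 : EuclideanSpace ℝ (Fin 2)) 1) → EuclideanSpace ℝ (Fin 4)) (Φ : ℝ × EuclideanSpace ℝ (Fin 4) → EuclideanSpace ℝ (Fin 4)) (ε s₁ s₀ : ℝ) (g : EuclideanSpace ℝ (Fin 2) → EuclideanSpace ℝ (Fin 4)) (G : EuclideanSpace ℝ (Fin 2) × EuclideanSpace ℝ (Fin 2) → EuclideanSpace ℝ (Fin 4)) (ν : (sphere (0 : EuclideanSpace ℝ (Fin 2)) 1) × EuclideanSpace ℝ (Fin 2) → EuclideanSpace ℝ (Fin 4)), IsModelKnot k K₁ → ContDiff ℝ ∞ Φ → (∀ x, Φ (0, x) = x) → (∀ s t x, Φ (s, Φ (t, x)) = Φ (s + t, x)) → 0 < ε → ε ≤ 1 / 4 → (∀ x ∈ modelBoundary k, ∀ s : ℝ,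 |s| ≤ 2 * ε → (∀ j, (1 : ℝ) / 2 < holeTerm k j (Φ (s, x))) ∧ levelFun k (Φ (s, x)) = 1 + s) → (∀ y, (∀ j, 0 < holeTerm k j y) → |levelFun k y - 1| < 2 * ε → Φ (1 - levelFun k y, y) ∈ modelBoundary k) → 0 < s₀ → s₀ < s₁ → s₁ < 2 * ε → IsModelSliceDisc k K₁ g → (∀ (u : (sphere (0 : EuclideanSpace ℝ (Fin 2)) 1)) (t : ℝ), 1 - s₁ ≤ t → t ≤ 1 → g (t • (u : EuclideanSpace ℝ (Fin 2))) = Φ (1 - t, K₁ u)) → (ContDiffOn ℝ ∞ G (ball 0 1 ×ˢ ball 0 2) ∧ InjOn G (ball 0 1 ×ˢ ball 0 2) ∧ (∀ q ∈ ball 0 1 ×ˢ ball 0 2, Injective (fderiv ℝ G q)) ∧ (∀ q ∈ ball 0 1 ×ˢ ball 0 2, G q ∉ modelHandlebody k) ∧ (∀ x ∈ ball 0 1, G (x, 0) = g x)) → (∀ (u : (sphere (0 : EuclideanSpace ℝ (Fin 2)) 1)) (t : ℝ) (w : EuclideanSpace ℝ (Fin 2)), 1 - s₁ < t → t < 1 →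 ‖w‖ < 2 → G (t • (u : EuclideanSpace ℝ (Fin 2)), w) = Φ (1 - t, ν (u, w))) → (∀ (x w : EuclideanSpace ℝ (Fin 2)), ‖x‖ ≤ 1 - s₀ → ‖w‖ < 2 → ∀ a ∈ modelBoundary k, ∀ s : ℝ, 0 < s → s < s₀ → G (x, w) ≠ Φ (s, a)) → ∀ (Y : Type) [TopologicalSpace Y] [T2Space Y] [SecondCountableTopology Y] [ChartedSpace (EuclideanSpace ℝ (Fin 3)) Y] [IsManifold (𝓡 3) ∞ Y] (jB : solidTorus → Y) (jM : EuclideanSpace ℝ (Fin 4) → Y) (W : Set (EuclideanSpace ℝ (Fin 4))) (ψ : Y → EuclideanSpace ℝ (Fin 4)), (Manifold.IsSmoothEmbedding (𝓘(ℝ, EuclideanSpace ℝ (Fin 2)).prod (𝓡 1)) (𝓡 3) ∞ jB ∧ IsOpen (range jB) ∧ ContMDiff ((𝓡 1).prod 𝓘(ℝ, EuclideanSpace ℝ (Fin 2))) 𝓘(ℝ, EuclideanSpace ℝ (Fin 4)) ∞ ν ∧ Injective ν ∧ (∀ p, Injective (mfderiv ((𝓡 1).prod 𝓘(ℝ, EuclideanSpace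 ℝ (Fin 2))) 𝓘(ℝ, EuclideanSpace ℝ (Fin 4)) ν p)) ∧ (∀ p, ν p ∈ modelBoundary k) ∧ (∀ u : (sphere (0 : EuclideanSpace ℝ (Fin 2)) 1), ν (u, 0) = K₁ u) ∧ IsOpen W ∧ (∀ x ∈ modelBoundary k, x ∉ range K₁ → x ∈ W) ∧ ContMDiffOn 𝓘(ℝ, EuclideanSpace ℝ (Fin 4)) (𝓡 3) ∞ jM W ∧ IsOpen (jM '' {x : EuclideanSpace ℝ (Fin 4) | x ∈ modelBoundary k ∧ x ∉ range K₁}) ∧ ContMDiffOn (𝓡 3) 𝓘(ℝ, EuclideanSpace ℝ (Fin 4)) ∞ ψ (jM '' {x : EuclideanSpace ℝ (Fin 4) | x ∈ modelBoundary k ∧ x ∉ range K₁}) ∧ (∀ x ∈ modelBoundary k, x ∉ range K₁ → ψ (jM x) = x) ∧ jM '' {x : EuclideanSpace ℝ (Fin 4) | x ∈ modelBoundary k ∧ x ∉ range K₁} ∪ range jB = univ ∧ (∀ x ∈ modelBoundary k, x ∉ range K₁ → ∀ b : solidTorus, jM x = jB b ↔ ∃ (u : (sphere (0 : EuclideanSpace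 ℝ (Fin 2)) 1)) (t : ℝ), t ∈ Ioo (0 : ℝ) 1 ∧ b.1.1 = t • (u : EuclideanSpace ℝ (Fin 2)) ∧ x = ν (u, t • (b.1.2 : EuclideanSpace ℝ (Fin 2))))) → ∀ E : Opens (EuclideanSpace ℝ (Fin 4)), (E : Set (EuclideanSpace ℝ (Fin 4))) = {x | x ∉ modelHandlebody k ∧ x ∉ g '' closedBall 0 1} → ∃ c : OpenPartialHomeomorph (Y × ℝ) E, c.source = univ ∧ ContMDiffOn ((𝓡 3).prod 𝓘(ℝ, ℝ)) (𝓡 4) ∞ c c.source ∧ ContMDiffOn (𝓡 4) ((𝓡 3).prod 𝓘(ℝ, ℝ)) ∞ c.symm c.target ∧ (∀ a : ℝ, IsClosed (c '' {q | q.2 ≤ a})) ∧ (∀ a : ℝ, IsClosed (((↑) : E → EuclideanSpace ℝ (Fin 4)) '' (c.targetᶜ ∪ c '' {q | a ≤ q.2}))) ∧ (∃ R : ℝ, ∀ q : Y × ℝ, ‖((c q : E) : EuclideanSpace ℝ (Fin 4))‖ ≤ R) ∧ ∀ (v : (sphere (0 : EuclideanSpace ℝ (Fin 2)) 1)) (b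 : solidTorus), b.1 = (0, v) → ((c (jB b, 0) : E) : EuclideanSpace ℝ (Fin 4)) = G (0, (1 / 2 : ℝ) • (v : EuclideanSpace ℝ (Fin 2))) := by
  intro k K₁ Φ ε s₁ s₀ g G ν hK hΦ hΦ0 hΦadd hε hε4 hclock hband hs₀ hs₀₁ hs₁ε hg hgcone hG hGcone hdeep Y _ _ _ _ _ jB jM W ψ
    ⟨h1, h2, h3, h4, h5, h6, h7, h8, h9, h10, h11, h12, h13, h14, h15⟩ E hE
  let V : FriendsVk.CollarDatum k :=
    FriendsVk.CollarDatum.datumOf hK hΦ hΦ0 hΦadd hε hε4 hclock hband hs₀ hs₀₁ hs₁ε hg hgcone hG hGcone hdeep h3 h4 h5 h6 h7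
  obtain ⟨Q, hQM, hQB, hQψ⟩ := FriendsVk.CollarDatum.Pres.ofHyp_spec V h1 h2 h8 h9 h10 h11 h12 h13 h14 h15
  have hEO : ∀ x : EuclideanSpace ℝ (Fin 4), x ∈ E ↔ x ∈ V.O := fun x => by
    rw [← SetLike.mem_coe, hE]; rfl
  -- the collar as an open partial homeomorphism onto the collar region
  let c : OpenPartialHomeomorph (Y × ℝ) E :=
  { toFun := fun p => ⟨V.collar Q.jM Q.jB Q.ψ p, (hEO _).2 (Q.collar_mem_O p)⟩
    invFun := fun z => V.collarInv Q.jM Q.jB (z : EuclideanSpace ℝ (Fin 4))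
    source := univ
    target := {z | (z : EuclideanSpace ℝ (Fin 4)) ∈ V.region}
    map_source' := fun p _ => Q.collar_mem_region p
    map_target' := fun _ _ => mem_univ _
    left_inv' := fun p _ => Q.collarInv_collar p
    right_inv' := fun z hz => Subtype.ext (Q.collar_collarInv hz)
    open_source := isOpen_univ
    open_target := V.isOpen_region.preimage continuous_subtype_val
    continuousOn_toFun := (Q.contMDiff_collar.continuous.subtype_mk _).continuousOn
    continuousOn_invFun := Q.contMDiffOn_collarInv.continuousOn.comp continuous_subtype_val.continuousOn fun _ hz => hz }
  have hc_apply : ∀ p, ((c p : E) : EuclideanSpace ℝ (Fin 4)) = V.collar Q.jM Q.jB Q.ψ p := fun _ => rfl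
  refine ⟨c, rfl, ?_, ?_, fun a => ?_, fun a => ?_, ?_, fun v b hb => ?_⟩
  · -- smoothness
    intro p _
    refine ContMDiffAt.contMDiffWithinAt ?_
    rw [← ContMDiffAt.subtypeVal_comp_iff]
    exact Q.contMDiff_collar.contMDiffAt
  · -- smoothness of the inverse
    exact Q.contMDiffOn_collarInv.comp contMDiff_subtype_val.contMDiffOn fun _ hz => hz
  · -- end clause 1: `c(Y × (-∞, a])` is closed in the exterior
    have heq : (c : Y × ℝ → E) '' {q | q.2 ≤ a} = Subtype.val ⁻¹' closure {z | z ∈ V.O ∧ Real.exp (-a) ≤ V.M z} := by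
      ext z
      have hzO : (z : EuclideanSpace ℝ (Fin 4)) ∈ V.O := (hEO _).1 z.2
      constructor
      · rintro ⟨p, hp, rfl⟩
        refine subset_closure ?_
        show V.collar Q.jM Q.jB Q.ψ p ∈ {z | z ∈ V.O ∧ Real.exp (-a) ≤ V.M z}
        rw [← Q.image_collar_le a]; exact ⟨p, hp, rfl⟩
      · intro hz
        have hmem : (z : EuclideanSpace ℝ (Fin 4)) ∈ {z | z ∈ V.O ∧ Real.exp (-a) ≤ V.M z} := V.closure_setOf_le_M_inter ⟨hz, hzO⟩
        rw [← Q.image_collar_le a] at hmem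
        obtain ⟨p, hp, hpz⟩ := hmem
        exact ⟨p, hp, Subtype.ext hpz⟩
    rw [heq]
    exact isClosed_closure.preimage continuous_subtype_val
  · -- end clause 2: the far part is closed in `ℝ⁴`
    have heq : ((↑) : E → EuclideanSpace ℝ (Fin 4)) '' (c.targetᶜ ∪ (c : Y × ℝ → E) '' {q | a ≤ q.2}) =
        (V.O \ V.region) ∪ V.collar Q.jM Q.jB Q.ψ '' {p | a ≤ p.2} := by
      ext z
      constructor
      · rintro ⟨z', hz', rfl⟩
        rcases hz' with h | ⟨p, hp, rfl⟩
        · exact Or.inl ⟨(hEO _).1 z'.2, h⟩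
        · exact Or.inr ⟨p, hp, rfl⟩
      · rintro (⟨hzO, hz⟩ | ⟨p, hp, rfl⟩)
        · exact ⟨⟨z, (hEO z).2 hzO⟩, Or.inl hz, rfl⟩
        · exact ⟨c p, Or.inr ⟨p, hp, rfl⟩, rfl⟩
    rw [heq, Q.diff_union_image_collar_ge]
    exact V.isClosed_sublevel a
  · -- bounded image
    obtain ⟨R, hR⟩ := V.exists_norm_le_of_mem_region
    exact ⟨R, fun q => hR _ (Q.collar_mem_region q)⟩
  · -- the core loop is the tube meridian
    have hsolid : ((0 : EuclideanSpace ℝ (Fin 2)), v) ∈ solidTorus := by simp [mem_solidTorus_iff]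
    have hb' : b = ⟨((0 : EuclideanSpace ℝ (Fin 2)), v), hsolid⟩ := Subtype.ext hb
    have hψ1 : TraceCollar.ψinv 1 = 1 := by
      rw [TraceCollar.ψinv, Real.log_one]; norm_num
    rw [hc_apply, hb', ← hQB, Q.collar_of_core v hsolid 0, FriendsVk.CollarDatum.cFlat]
    simp only [smul_zero, neg_zero, Real.exp_zero]
    rw [SliceCollar.Einv, hψ1]
    norm_num
    rfl

end Summit.SmoothPoincare4.SmoothPoincare4.Theorems.DcrGap.MkFriends

end
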